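import Mathlib.Combinatorics.SetFamily.FourFunctions
import Literature.Probability.LatticeModels.SahiThirdOrderCorrelation
import Summits.CriticalPhenomena.PercolationContinuityZ3.Theorems.PercNearOneGluingNoHeavyLowerTailC3Transport
import Mathlib.Tactic.Linarith
import Mathlib.Tactic.Ring
import HarnessLib
import HarnessLib.Audit

/-!
# `NoHeavyLowerTail` (crux stmt-CriticalPhenomena-4575), Sahi programme P4 (Holley / monotone coupling):
# the LOAD of the cross-fibre transport for a principal pairwise intersection — objects and steps 1–3

Support file (cell `prim-l12`, seat P4; `--supports stmt-CriticalPhenomena-4575`), first half of the proof of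
`…SahiE3PrincipalMeetFKG.latticeE3_nonneg_of_inter_eq_principalUp` (Sahi's `C₃` for EVERY nonnegative log-supermodular weight
on a finite distributive lattice when `A ∩ B = {x | c ≤ x}` is principal; statement, context and the half-page proof are in the
module docstring of `…SahiE3PrincipalMeetFKG.lean`).  No named facts, no sorries; the `def`s are proof devices (finite sets and
real-valued coefficients), not new notions.

Contents (notation `Z = m(univ)`, `a = m(A)`, `b = m(B)`, `P = principalUp c`):
* objects: the top-section cylinder `starUp A c = {x | ∃ a' ∈ A, a' ⊓ c ≤ x}` (`A ⊆ A*`, up-set, `A* ∩ B* = P` when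
  `A ∩ B = P` — `starUp_inter_starUp`), the saturation `satUp U c = {x | x ⊔ c ∈ U}`, the fibres `fibre c y = {x | x ⊔ c = y}`,
  the dominating supply coefficient `coefStar = (Z·m(A∩B) − ab) + Za·1_{B*} + Zb·1_{A*}` and the fibre LOAD
  `load y = Σ_{x ∈ fibre c y} μ x · coefStar x`;
* STEP 1 (saturation) `latticeE3_satUp_le`: `latticeE3 μ (satUp U c) A B ≤ latticeE3 μ U A B`;
* STEP 2 (collection along fibres) `latticeE3_satUp_ge`: `2Z²·m(U ∩ P) − Σ_{y ∈ U ∩ P} load y ≤ latticeE3 μ (satUp U c) A B`;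
* STEP 3 (Holley) `load_holley`: `load y₁ · μ y₂ ≤ load (y₁ ⊓ y₂) · μ (y₁ ⊔ y₂)` for `c ≤ y₂` (termwise log-supermodularity,
  distributivity `(x ⊓ y₂) ⊔ c = (x ⊔ c) ⊓ y₂`, injectivity of `x ↦ x ⊓ y₂` on a fibre — `inf_injOn_fibre`), and the
  Ahlswede–Daykin consequence `sum_load_mul_le`: `(Σ_{y∈V} load y)·m(P) ≤ (Σ_{y∈P} load y)·m(V)` for every up-set `V ⊆ P`
  (Mathlib `four_functions_theorem_univ` on the FKG sublattice `P`).
-/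

namespace Summit.CriticalPhenomena.PercolationContinuityZ3.Theorems.SahiE3PrincipalMeetFKG

open Finset Literature.Probability.LatticeModels
open Summit.CriticalPhenomena.PercolationContinuityZ3.Theorems.C3Transport (density latticeE3_eq_sum_density)

variable {α : Type*} [DistribLattice α] [Fintype α] [DecidableEq α] [DecidableLE α]

/-! ### The objects: top sections, saturation, supply coefficients, fibre loads -/

/-- The TOP-SECTION cylinder `A* = {x | ∃ a' ∈ A, a' ⊓ c ≤ x}` of `A` relative to `c` (on a cube `{0,1}^{D ⊔ c}`: the points whose
`c`-block lies in the section of `A` over the all-ones configuration of `D`). [this work] -/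
def starUp (A : Finset α) (c : α) : Finset α := univ.filter fun x => ∃ a' ∈ A, a' ⊓ c ≤ x

/-- The `c`-SATURATION `{x | x ⊔ c ∈ U}` of `U`. [this work] -/
def satUp (U : Finset α) (c : α) : Finset α := univ.filter fun x => x ⊔ c ∈ U

/-- The fibre `{x | x ⊔ c = y}` of `x ↦ x ⊔ c` over `y`. [this work] -/
def fibre (c y : α) : Finset α := univ.filter fun x => x ⊔ c = y

/-- The dominating SUPPLY coefficient `λ x = (Z·m(A ∩ B) − m(A)m(B)) + Z·m(A)·1_{B*}(x) + Z·m(B)·1_{A*}(x)`. [this work] -/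
def coefStar (μ : α → ℝ) (A B : Finset α) (c x : α) : ℝ :=
  (mass μ univ * mass μ (A ∩ B) - mass μ A * mass μ B)
    + mass μ univ * mass μ A * (if x ∈ starUp B c then 1 else 0)
    + mass μ univ * mass μ B * (if x ∈ starUp A c then 1 else 0)

/-- The LOAD `H y = Σ_{x : x ⊔ c = y} μ x · λ x` arriving at `y` when every point sends its (dominated) supply to the top of
its fibre. [this work] -/
def load (μ : α → ℝ) (A B : Finset α) (c y : α) : ℝ := ∑ x ∈ fibre c y, μ x * coefStar μ A B c x

/-! ### Membership lemmas -/

omit [DecidableLE α] in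
/-- Membership in the fibre. [this work] -/
theorem mem_fibre {c y x : α} : x ∈ fibre c y ↔ x ⊔ c = y := by
  simp [fibre]

omit [DecidableLE α] in
/-- Membership in the saturation. [this work] -/
theorem mem_satUp {U : Finset α} {c x : α} : x ∈ satUp U c ↔ x ⊔ c ∈ U := by
  simp [satUp]

omit [DecidableEq α] in
/-- Membership in the top-section cylinder. [this work] -/
theorem mem_starUp {A : Finset α} {c x : α} : x ∈ starUp A c ↔ ∃ a' ∈ A, a' ⊓ c ≤ x := by
  simp [starUp]

omit [DecidableEq α] in
/-- `A ⊆ A*`. [this work] -/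
theorem subset_starUp (A : Finset α) (c : α) : A ⊆ starUp A c :=
  fun x hx => mem_starUp.2 ⟨x, hx, inf_le_left⟩

omit [DecidableEq α] in
/-- `A*` is an up-set. [this work] -/
theorem isUpperSet_starUp (A : Finset α) (c : α) : IsUpperSet ((starUp A c : Finset α) : Set α) := by
  intro x y hxy hx
  rw [Finset.mem_coe, mem_starUp] at hx ⊢
  obtain ⟨a', ha', hle⟩ := hx
  exact ⟨a', ha', le_trans hle hxy⟩

omit [DecidableEq α] in
/-- Membership in `A*` passes from `x` to `x ⊓ y` for `y ≥ c` (it depends on `x ⊓ c` only). [this work] -/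
theorem inf_mem_starUp {A : Finset α} {c x y : α} (hy : c ≤ y) (hx : x ∈ starUp A c) :
    x ⊓ y ∈ starUp A c := by
  rw [mem_starUp] at hx ⊢
  obtain ⟨a', ha', hle⟩ := hx
  exact ⟨a', ha', le_inf hle (le_trans inf_le_right hy)⟩

/-- **`A* ∩ B* = P`** when `A ∩ B = P = {x | c ≤ x}` (distributivity). [this work] -/
theorem starUp_inter_starUp {A B : Finset α} {c : α} (hA : IsUpperSet (A : Set α)) (hB : IsUpperSet (B : Set α))
    (hAB : A ∩ B = principalUp c) : starUp A c ∩ starUp B c = principalUp c := by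
  ext x
  rw [Finset.mem_inter, mem_starUp, mem_starUp, mem_principalUp]
  refine ⟨fun h => ?_, fun hx => ?_⟩
  · obtain ⟨⟨a', ha', hale⟩, ⟨b', hb', hble⟩⟩ := h
    -- `z = a' ⊔ b' ⊔ x ∈ A ∩ B = P`, so `c ≤ z`, and `c = c ⊓ z ≤ x` by distributivity
    have hzA : a' ⊔ b' ⊔ x ∈ A := hA (le_trans le_sup_left le_sup_left : a' ≤ a' ⊔ b' ⊔ x) ha'
    have hzB : a' ⊔ b' ⊔ x ∈ B := hB (le_trans le_sup_right le_sup_left : b' ≤ a' ⊔ b' ⊔ x) hb'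
    have hz : a' ⊔ b' ⊔ x ∈ principalUp c := by rw [← hAB]; exact Finset.mem_inter.2 ⟨hzA, hzB⟩
    rw [mem_principalUp] at hz
    calc c = c ⊓ (a' ⊔ b' ⊔ x) := (inf_eq_left.2 hz).symm
      _ = (c ⊓ a' ⊔ c ⊓ b') ⊔ c ⊓ x := by rw [inf_sup_left, inf_sup_left]
      _ ≤ x := sup_le (sup_le (le_trans (by rw [inf_comm]) hale) (le_trans (by rw [inf_comm]) hble)) inf_le_right
  · have hxP : x ∈ A ∩ B := by rw [hAB]; exact mem_principalUp.2 hx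
    exact ⟨⟨x, (Finset.mem_inter.1 hxP).1, inf_le_left⟩, ⟨x, (Finset.mem_inter.1 hxP).2, inf_le_left⟩⟩

/-! ### Nonnegativity and domination of the supply coefficients -/

omit [DecidableLE α] in
/-- `0 ≤ Z·m(A ∩ B) − m(A)m(B)` (FKG for the up-sets `A, B`). [this work] -/
theorem cov_nonneg {μ : α → ℝ} (hμ₀ : 0 ≤ μ) (hμ : ∀ a b, μ a * μ b ≤ μ (a ⊓ b) * μ (a ⊔ b)) {A B : Finset α}
    (hA : IsUpperSet (A : Set α)) (hB : IsUpperSet (B : Set α)) :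
    0 ≤ mass μ univ * mass μ (A ∩ B) - mass μ A * mass μ B :=
  sub_nonneg.2 (fkg_upperSet_mass hμ₀ hμ hA hB)

/-- `0 ≤ λ x`. [this work] -/
theorem coefStar_nonneg {μ : α → ℝ} (hμ₀ : 0 ≤ μ) (hμ : ∀ a b, μ a * μ b ≤ μ (a ⊓ b) * μ (a ⊔ b))
    {A B : Finset α} (hA : IsUpperSet (A : Set α)) (hB : IsUpperSet (B : Set α)) (c x : α) :
    0 ≤ coefStar μ A B c x := by
  have hZ := mass_nonneg hμ₀ (univ : Finset α)
  have ha := mass_nonneg hμ₀ A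
  have hb := mass_nonneg hμ₀ B
  have h0 := cov_nonneg hμ₀ hμ hA hB
  have h1 : 0 ≤ mass μ univ * mass μ A * (if x ∈ starUp B c then (1 : ℝ) else 0) := by
    split_ifs <;> positivity
  have h2 : 0 ≤ mass μ univ * mass μ B * (if x ∈ starUp A c then (1 : ℝ) else 0) := by
    split_ifs <;> positivity
  unfold coefStar
  exact add_nonneg (add_nonneg h0 h1) h2

/-- `λ x ≤ λ (x ⊓ y)` for `y ≥ c`. [this work] -/
theorem coefStar_le_coefStar_inf {μ : α → ℝ} (hμ₀ : 0 ≤ μ) (A B : Finset α) {c x y : α} (hy : c ≤ y) :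
    coefStar μ A B c x ≤ coefStar μ A B c (x ⊓ y) := by
  have hZ := mass_nonneg hμ₀ (univ : Finset α)
  have ha := mass_nonneg hμ₀ A
  have hb := mass_nonneg hμ₀ B
  have h1 : (if x ∈ starUp B c then (1 : ℝ) else 0) ≤ (if x ⊓ y ∈ starUp B c then (1 : ℝ) else 0) := by
    by_cases hx : x ∈ starUp B c
    · rw [if_pos hx, if_pos (inf_mem_starUp hy hx)]
    · rw [if_neg hx]; split_ifs <;> norm_num
  have h2 : (if x ∈ starUp A c then (1 : ℝ) else 0) ≤ (if x ⊓ y ∈ starUp A c then (1 : ℝ) else 0) := by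
    by_cases hx : x ∈ starUp A c
    · rw [if_pos hx, if_pos (inf_mem_starUp hy hx)]
    · rw [if_neg hx]; split_ifs <;> norm_num
  have h1' := mul_le_mul_of_nonneg_left h1 (mul_nonneg hZ ha)
  have h2' := mul_le_mul_of_nonneg_left h2 (mul_nonneg hZ hb)
  unfold coefStar
  exact add_le_add (add_le_add le_rfl h1') h2'

/-- **Domination of the true supply by `λ`**:
`2Z²·μ x·1_{A∩B}(x) − μ x · λ x ≤ μ x · density μ A B x` (uses `A ⊆ A*`, `B ⊆ B*`). [this work] -/
theorem mul_density_ge {μ : α → ℝ} (hμ₀ : 0 ≤ μ) (A B : Finset α) (c x : α) :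
    2 * mass μ univ ^ 2 * (μ x * (if x ∈ A ∩ B then 1 else 0)) - μ x * coefStar μ A B c x ≤
      μ x * density μ A B x := by
  have hZ := mass_nonneg hμ₀ (univ : Finset α)
  have ha := mass_nonneg hμ₀ A
  have hb := mass_nonneg hμ₀ B
  have hx := hμ₀ x
  have h1 : (if x ∈ B then (1 : ℝ) else 0) ≤ (if x ∈ starUp B c then (1 : ℝ) else 0) := by
    by_cases hxB : x ∈ B
    · rw [if_pos hxB, if_pos (subset_starUp B c hxB)]
    · rw [if_neg hxB]; split_ifs <;> norm_num
  have h2 : (if x ∈ A then (1 : ℝ) else 0) ≤ (if x ∈ starUp A c then (1 : ℝ) else 0) := by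
    by_cases hxA : x ∈ A
    · rw [if_pos hxA, if_pos (subset_starUp A c hxA)]
    · rw [if_neg hxA]; split_ifs <;> norm_num
  have key : μ x * density μ A B x -
      (2 * mass μ univ ^ 2 * (μ x * (if x ∈ A ∩ B then 1 else 0)) - μ x * coefStar μ A B c x) =
      μ x * (mass μ univ * mass μ A) * ((if x ∈ starUp B c then (1 : ℝ) else 0) - (if x ∈ B then (1 : ℝ) else 0))
        + μ x * (mass μ univ * mass μ B) *
          ((if x ∈ starUp A c then (1 : ℝ) else 0) - (if x ∈ A then (1 : ℝ) else 0)) := by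
    unfold density coefStar; ring
  have t1 : 0 ≤ μ x * (mass μ univ * mass μ A) *
      ((if x ∈ starUp B c then (1 : ℝ) else 0) - (if x ∈ B then (1 : ℝ) else 0)) :=
    mul_nonneg (mul_nonneg hx (mul_nonneg hZ ha)) (sub_nonneg.2 h1)
  have t2 : 0 ≤ μ x * (mass μ univ * mass μ B) *
      ((if x ∈ starUp A c then (1 : ℝ) else 0) - (if x ∈ A then (1 : ℝ) else 0)) :=
    mul_nonneg (mul_nonneg hx (mul_nonneg hZ hb)) (sub_nonneg.2 h2)
  linarith

/-! ### Step 1: saturation -/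

omit [DecidableLE α] in
/-- `U ⊆ U'` for an up-set `U`. [this work] -/
theorem subset_satUp {U : Finset α} (hU : IsUpperSet (U : Set α)) (c : α) : U ⊆ satUp U c :=
  fun x hx => mem_satUp.2 (hU (le_sup_left : x ≤ x ⊔ c) hx)

omit [DecidableLE α] in
/-- On `P` the saturation does nothing: for `c ≤ x`, `x ∈ U' ↔ x ∈ U`. [this work] -/
theorem mem_satUp_of_le {U : Finset α} {c x : α} (hx : c ≤ x) : x ∈ satUp U c ↔ x ∈ U := by
  rw [mem_satUp, sup_eq_left.2 hx]

/-- **Saturation decreases the functional**: `latticeE3 μ U' A B ≤ latticeE3 μ U A B` when `A ∩ B = P` (the points added lie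
off `P`, where the first-slot density is `−λ₀ ≤ 0`). [this work] -/
theorem latticeE3_satUp_le {μ : α → ℝ} (hμ₀ : 0 ≤ μ) (hμ : ∀ a b, μ a * μ b ≤ μ (a ⊓ b) * μ (a ⊔ b))
    {U A B : Finset α} (hU : IsUpperSet (U : Set α)) (hA : IsUpperSet (A : Set α)) (hB : IsUpperSet (B : Set α))
    {c : α} (hAB : A ∩ B = principalUp c) :
    latticeE3 μ (satUp U c) A B ≤ latticeE3 μ U A B := by
  rw [latticeE3_eq_sum_density, latticeE3_eq_sum_density, ← Finset.sum_sdiff (subset_satUp hU c)]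
  -- on `U' \ U` the density is `≤ 0`
  have hneg : ∑ x ∈ satUp U c \ U, μ x * density μ A B x ≤ 0 := by
    apply Finset.sum_nonpos
    intro x hx
    rw [Finset.mem_sdiff] at hx
    have hxP : x ∉ A ∩ B := by
      intro h
      rw [hAB, mem_principalUp] at h
      exact hx.2 ((mem_satUp_of_le h).1 hx.1)
    have hZ := mass_nonneg hμ₀ (univ : Finset α)
    have ha := mass_nonneg hμ₀ A
    have hb := mass_nonneg hμ₀ B
    have h0 := cov_nonneg hμ₀ hμ hA hB
    have h1 : 0 ≤ mass μ univ * mass μ A * (if x ∈ B then (1 : ℝ) else 0) := by split_ifs <;> positivity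
    have h2 : 0 ≤ mass μ univ * mass μ B * (if x ∈ A then (1 : ℝ) else 0) := by split_ifs <;> positivity
    have hd : density μ A B x ≤ 0 := by
      unfold density
      rw [if_neg hxP, mul_zero, zero_add]
      linarith
    exact mul_nonpos_of_nonneg_of_nonpos (hμ₀ x) hd
  linarith

/-! ### Step 2: collecting the dominated supply along the fibres of `x ↦ x ⊔ c` -/

/-- Lower bound for the saturated functional: `latticeE3 μ U' A B ≥ 2Z²·m(U ∩ P) − Σ_{y ∈ U ∩ P} H y`. [this work] -/
theorem latticeE3_satUp_ge {μ : α → ℝ} (hμ₀ : 0 ≤ μ) {U A B : Finset α} {c : α} (hAB : A ∩ B = principalUp c) :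
    2 * mass μ univ ^ 2 * mass μ (U ∩ principalUp c) - ∑ y ∈ U ∩ principalUp c, load μ A B c y ≤
      latticeE3 μ (satUp U c) A B := by
  rw [latticeE3_eq_sum_density]
  -- pointwise domination, summed over `U'`
  have hdom : ∑ x ∈ satUp U c, (2 * mass μ univ ^ 2 * (μ x * (if x ∈ A ∩ B then 1 else 0)) -
      μ x * coefStar μ A B c x) ≤ ∑ x ∈ satUp U c, μ x * density μ A B x :=
    Finset.sum_le_sum fun x _ => mul_density_ge hμ₀ A B c x
  rw [Finset.sum_sub_distrib, ← Finset.mul_sum] at hdom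
  -- the indicator sum is `m(U' ∩ P) = m(U ∩ P)`
  have hind : ∑ x ∈ satUp U c, μ x * (if x ∈ A ∩ B then (1 : ℝ) else 0) = mass μ (U ∩ principalUp c) := by
    simp only [mul_ite, mul_one, mul_zero]
    rw [Finset.sum_ite_mem, hAB]
    have hset : satUp U c ∩ principalUp c = U ∩ principalUp c := by
      ext x
      simp only [Finset.mem_inter, mem_principalUp]
      constructor
      · rintro ⟨h1, h2⟩; exact ⟨(mem_satUp_of_le h2).1 h1, h2⟩
      · rintro ⟨h1, h2⟩; exact ⟨(mem_satUp_of_le h2).2 h1, h2⟩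
    rw [hset]
    rfl
  -- the load sum is the fibrewise regrouping of the dominated supply over `U'`
  have hload : ∑ x ∈ satUp U c, μ x * coefStar μ A B c x = ∑ y ∈ U ∩ principalUp c, load μ A B c y := by
    have hmaps : ∀ x ∈ satUp U c, x ⊔ c ∈ U ∩ principalUp c :=
      fun x hx => Finset.mem_inter.2 ⟨mem_satUp.1 hx, mem_principalUp.2 le_sup_right⟩
    rw [← Finset.sum_fiberwise_of_maps_to hmaps (fun x => μ x * coefStar μ A B c x)]
    unfold load
    apply Finset.sum_congr rfl
    intro y hy
    apply Finset.sum_congr _ (fun _ _ => rfl)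
    ext x
    rw [Finset.mem_filter, mem_fibre, mem_satUp]
    constructor
    · rintro ⟨_, h⟩; exact h
    · intro h; exact ⟨by rw [h]; exact (Finset.mem_inter.1 hy).1, h⟩
  rw [hind, hload] at hdom
  exact hdom

/-! ### Step 3: the Holley condition for the load, and the four functions theorem on `P` -/

omit [DecidableLE α] in
/-- Injectivity of `x ↦ x ⊓ y` on a fibre of `x ↦ x ⊔ c` (`c ≤ y`): an element of a distributive lattice is determined by
`x ⊓ c` and `x ⊔ c`. [this work] -/
theorem inf_injOn_fibre {c y a : α} (hy : c ≤ y) : Set.InjOn (fun x => x ⊓ y) ((fibre c a : Finset α) : Set α) := by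
  intro x₁ hx₁ x₂ hx₂ h
  rw [Finset.mem_coe, mem_fibre] at hx₁ hx₂
  have h' : x₁ ⊓ y = x₂ ⊓ y := h
  have hc : x₁ ⊓ c = x₂ ⊓ c := by
    calc x₁ ⊓ c = x₁ ⊓ (y ⊓ c) := by rw [inf_eq_right.2 hy]
      _ = (x₁ ⊓ y) ⊓ c := (inf_assoc _ _ _).symm
      _ = (x₂ ⊓ y) ⊓ c := by rw [h']
      _ = x₂ ⊓ c := by rw [inf_assoc, inf_eq_right.2 hy]
  have key : ∀ {u v : α}, u ⊔ c = v ⊔ c → u ⊓ c = v ⊓ c → u ≤ v := by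
    intro u v huv huc
    calc u = u ⊓ (u ⊔ c) := inf_sup_self.symm
      _ = u ⊓ (v ⊔ c) := by rw [huv]
      _ = u ⊓ v ⊔ u ⊓ c := inf_sup_left _ _ _
      _ = u ⊓ v ⊔ v ⊓ c := by rw [huc]
      _ ≤ v := sup_le inf_le_right inf_le_left
  exact le_antisymm (key (hx₁.trans hx₂.symm) hc) (key (hx₂.trans hx₁.symm) hc.symm)

/-- **Holley condition for the load**: `H y₁ · μ y₂ ≤ H (y₁ ⊓ y₂) · μ (y₁ ⊔ y₂)` for `y₂ ≥ c` (termwise log-supermodularity,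
distributivity, and injectivity of `x ↦ x ⊓ y₂` on the fibre). [this work] -/
theorem load_holley {μ : α → ℝ} (hμ₀ : 0 ≤ μ) (hμ : ∀ a b, μ a * μ b ≤ μ (a ⊓ b) * μ (a ⊔ b))
    {A B : Finset α} (hA : IsUpperSet (A : Set α)) (hB : IsUpperSet (B : Set α)) (c : α) {y₁ y₂ : α} (hy₂ : c ≤ y₂) :
    load μ A B c y₁ * μ y₂ ≤ load μ A B c (y₁ ⊓ y₂) * μ (y₁ ⊔ y₂) := by
  unfold load
  rw [Finset.sum_mul, Finset.sum_mul]
  have hnn : ∀ x, 0 ≤ μ x * coefStar μ A B c x * μ (y₁ ⊔ y₂) := fun x =>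
    mul_nonneg (mul_nonneg (hμ₀ x) (coefStar_nonneg hμ₀ hμ hA hB c x)) (hμ₀ _)
  calc ∑ x ∈ fibre c y₁, μ x * coefStar μ A B c x * μ y₂
      ≤ ∑ x ∈ fibre c y₁, μ (x ⊓ y₂) * coefStar μ A B c (x ⊓ y₂) * μ (y₁ ⊔ y₂) := by
        apply Finset.sum_le_sum
        intro x hx
        rw [mem_fibre] at hx
        have hsup : x ⊔ y₂ = y₁ ⊔ y₂ := by
          rw [← hx, sup_assoc, sup_eq_right.2 hy₂]
        have h1 : μ x * μ y₂ ≤ μ (x ⊓ y₂) * μ (y₁ ⊔ y₂) := by rw [← hsup]; exact hμ x y₂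
        have h2 := coefStar_le_coefStar_inf (μ := μ) hμ₀ A B (x := x) hy₂
        have h3 := coefStar_nonneg hμ₀ hμ hA hB c x
        calc μ x * coefStar μ A B c x * μ y₂ = (μ x * μ y₂) * coefStar μ A B c x := by ring
          _ ≤ (μ (x ⊓ y₂) * μ (y₁ ⊔ y₂)) * coefStar μ A B c (x ⊓ y₂) :=
              mul_le_mul h1 h2 h3 (mul_nonneg (hμ₀ _) (hμ₀ _))
          _ = μ (x ⊓ y₂) * coefStar μ A B c (x ⊓ y₂) * μ (y₁ ⊔ y₂) := by ring
    _ = ∑ x' ∈ (fibre c y₁).image (fun x => x ⊓ y₂), μ x' * coefStar μ A B c x' * μ (y₁ ⊔ y₂) := by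
        rw [Finset.sum_image (inf_injOn_fibre hy₂)]
    _ ≤ ∑ x' ∈ fibre c (y₁ ⊓ y₂), μ x' * coefStar μ A B c x' * μ (y₁ ⊔ y₂) := by
        apply Finset.sum_le_sum_of_subset_of_nonneg
        · intro x' hx'
          rw [Finset.mem_image] at hx'
          obtain ⟨x, hx, rfl⟩ := hx'
          rw [mem_fibre] at hx ⊢
          rw [sup_inf_right, hx, sup_eq_left.2 hy₂]
        · intro x _ _; exact hnn x

/-- **Four functions step**: for an up-set `V ⊆ P`, `(Σ_{y∈V} H y)·m(P) ≤ (Σ_{y∈P} H y)·m(V)` — the load density is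
Holley-decreasing on the FKG sublattice `P`, so its conditional mean on the up-set `V` is at most its mean. [this work] -/
theorem sum_load_mul_le {μ : α → ℝ} (hμ₀ : 0 ≤ μ) (hμ : ∀ a b, μ a * μ b ≤ μ (a ⊓ b) * μ (a ⊔ b))
    {A B : Finset α} (hA : IsUpperSet (A : Set α)) (hB : IsUpperSet (B : Set α)) (c : α)
    {V : Finset α} (hV : IsUpperSet (V : Set α)) (hVP : V ⊆ principalUp c) :
    (∑ y ∈ V, load μ A B c y) * mass μ (principalUp c) ≤ (∑ y ∈ principalUp c, load μ A B c y) * mass μ V := by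
  have hL : ∀ y, 0 ≤ load μ A B c y := fun y => Finset.sum_nonneg (fun x _ =>
    mul_nonneg (hμ₀ x) (coefStar_nonneg hμ₀ hμ hA hB c x))
  have hif1 : ∀ (q : Prop) [Decidable q] (y : α), 0 ≤ (if q then load μ A B c y else 0) := by
    intro q _ y; split_ifs; exacts [hL y, le_rfl]
  have hif2 : ∀ (q : Prop) [Decidable q] (y : α), 0 ≤ (if q then μ y else 0) := by
    intro q _ y; split_ifs; exacts [hμ₀ y, le_rfl]
  have key := four_functions_theorem_univ
    (fun y => if y ∈ V then load μ A B c y else 0)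
    (fun y => if y ∈ principalUp c then μ y else 0)
    (fun y => if y ∈ principalUp c then load μ A B c y else 0)
    (fun y => if y ∈ V then μ y else 0)
    (fun y => hif1 _ y) (fun y => hif2 _ y) (fun y => hif1 _ y) (fun y => hif2 _ y)
    (fun y₁ y₂ => show (if y₁ ∈ V then load μ A B c y₁ else 0) * (if y₂ ∈ principalUp c then μ y₂ else 0) ≤
        (if y₁ ⊓ y₂ ∈ principalUp c then load μ A B c (y₁ ⊓ y₂) else 0) *
          (if y₁ ⊔ y₂ ∈ V then μ (y₁ ⊔ y₂) else 0) from by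
      by_cases h₁ : y₁ ∈ V
      · by_cases h₂ : y₂ ∈ principalUp c
        · have hc₁ : c ≤ y₁ := mem_principalUp.1 (hVP h₁)
          have hc₂ : c ≤ y₂ := mem_principalUp.1 h₂
          have hinf : y₁ ⊓ y₂ ∈ principalUp c := mem_principalUp.2 (le_inf hc₁ hc₂)
          have hsup : y₁ ⊔ y₂ ∈ V := hV (le_sup_left : y₁ ≤ y₁ ⊔ y₂) h₁
          rw [if_pos h₁, if_pos h₂, if_pos hinf, if_pos hsup]
          exact load_holley hμ₀ hμ hA hB c hc₂
        · rw [if_neg h₂, mul_zero]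
          exact mul_nonneg (hif1 _ _) (hif2 _ _)
      · rw [if_neg h₁, zero_mul]
        exact mul_nonneg (hif1 _ _) (hif2 _ _))
  simp only [Finset.sum_ite_mem, Finset.univ_inter] at key
  exact key

end Summit.CriticalPhenomena.PercolationContinuityZ3.Theorems.SahiE3PrincipalMeetFKG
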